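import Literature.Computability.Complexity.SymbolPrograms
import HarnessLib

/-!
# Fuel: running a flat stack program under a clock, inside a larger flat program

Literature / complexity toolkit (the "exactly `j` units of work" device of the diagonalizer of
the nondeterministic time hierarchy theorem, `NTIMEHierarchyDiagonal.lean`). Given a flat binary
program `P : AProg Bool κ` (`SymbolPrograms.lean`: `push`/`pop`/`goto` on registers `κ`), an
injective renaming `g : κ → ι` of its registers into a bigger register file, a CLOCK register
`clk : ι` outside the range of `g`, a base address and an exit address `X`, the **ticked
program** `FlatFuel.tick g clk base X P : AProg Bool ι` consists of `2 |P|` instructions: in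
front of (the renamed, relocated copy of) every instruction of `P` stands `pop clk`, which
continues to the instruction if a clock token was popped and jumps to `X` if the clock is
empty; jump targets are relocated with saturation, so that every halting jump of `P` lands at
`base + 2|P|`.

* `FlatFuel.step_tick_fuel` / `FlatFuel.step_tick_empty` — one instruction of `P` is two
  instructions of the ticked program consuming one clock token; an empty clock exits to `X`;
* `FlatFuel.iterate_tick` — `n` unhalted steps of `P` with at least `n` tokens are `2n` steps
  of the ticked program, on stores grafted along `g` (`ACom.graft`), the clock losing `n`
  tokens and every other register untouched;
* `FlatFuel.tick_exhaust` / `FlatFuel.tick_complete` — the two outcomes for a run of `P` that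
  halts after exactly `J` steps: with `F < J` tokens the ticked program is at `X` after
  `2F + 1` steps with an empty clock; with `F ≥ J` tokens it is at `base + 2|P|` after `2J`
  steps with `F - J` tokens left — so the surrounding program learns whether `F < J`, `F = J`
  or `F > J` from the exit taken and the clock, at a cost of at most `2F + 1` steps.

## References

* S. Arora, B. Barak, *Computational Complexity: A Modern Approach*, CUP 2009, §1.4.1
  (universal simulation with a time counter), proof of Thm. 3.2.
* T. Nipkow, G. Klein, *Concrete Semantics with Isabelle/HOL*, Springer 2014, §8.3.
-/

namespace Literature.Computability.Complexity

open Function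

namespace FlatFuel

open ACom

variable {κ ι : Type} [DecidableEq κ] [DecidableEq ι]

/-- Relocation of a jump target with saturation at the end of the program. [folklore] -/
def sat (base len j : ℕ) : ℕ := base + 2 * min j len

/-- The renamed, relocated copy of an instruction. [folklore] -/
def reloc (g : κ → ι) (base len : ℕ) : AInstr Bool κ → AInstr Bool ι
  | .push k b => .push (g k) b
  | .pop k j => .pop (g k) fun o => sat base len (j o)
  | .goto j => .goto (sat base len j)

/-- The jump table of a clock test: exit to `X` on an empty clock, else continue at `t`.
[folklore] -/
def clkJump (X t : ℕ) : Option Bool → ℕ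
  | none => X
  | some _ => t

/-- The two instructions standing for instruction `i` at address `a`: the clock test, then the
copy. [folklore] -/
def pair (g : κ → ι) (clk : ι) (base len X : ℕ) (a : ℕ) (i : AInstr Bool κ) : List (AInstr Bool ι) :=
  [.pop clk (clkJump X (base + 2 * a + 1)), reloc g base len i]

/-- The ticked program from address counter `a` on. [folklore] -/
def tickFrom (g : κ → ι) (clk : ι) (base len X : ℕ) : ℕ → AProg Bool κ → AProg Bool ι
  | _, [] => []
  | a, i :: P => pair g clk base len X a i ++ tickFrom g clk base len X (a + 1) P

/-- **The ticked program.** [cite: AroraBarak2009, §1.4.1] -/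
def tick (g : κ → ι) (clk : ι) (base X : ℕ) (P : AProg Bool κ) : AProg Bool ι :=
  tickFrom g clk base P.length X 0 P

omit [DecidableEq κ] [DecidableEq ι] in
/-- Length of `tickFrom`. [folklore] -/
theorem length_tickFrom (g : κ → ι) (clk : ι) (base len X : ℕ) : ∀ (a : ℕ) (P : AProg Bool κ),
    (tickFrom g clk base len X a P).length = 2 * P.length
  | _, [] => rfl
  | a, i :: P => by
    rw [tickFrom, List.length_append, length_tickFrom g clk base len X (a + 1) P]
    simp [pair]; omega

omit [DecidableEq κ] [DecidableEq ι] in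
/-- The ticked program has `2 |P|` instructions. [folklore] -/
@[simp] theorem length_tick (g : κ → ι) (clk : ι) (base X : ℕ) (P : AProg Bool κ) :
    (tick g clk base X P).length = 2 * P.length := length_tickFrom g clk base P.length X 0 P

omit [DecidableEq κ] [DecidableEq ι] in
/-- The instructions of `tickFrom`. [folklore] -/
theorem getElem?_tickFrom (g : κ → ι) (clk : ι) (base len X : ℕ) : ∀ (a : ℕ) (P : AProg Bool κ) (a' : ℕ)
    (ins : AInstr Bool κ), P[a']? = some ins →
    (tickFrom g clk base len X a P)[2 * a']? = some (.pop clk (clkJump X (base + 2 * (a + a') + 1))) ∧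
    (tickFrom g clk base len X a P)[2 * a' + 1]? = some (reloc g base len ins)
  | a, [], a', ins, h => by simp at h
  | a, i :: P, 0, ins, h => by
    simp only [List.getElem?_cons_zero, Option.some.injEq] at h
    subst h
    simp [tickFrom, pair]
  | a, i :: P, a' + 1, ins, h => by
    rw [List.getElem?_cons_succ] at h
    have ih := getElem?_tickFrom g clk base len X (a + 1) P a' ins h
    rw [tickFrom, List.getElem?_append_right (by simp [pair]),
      List.getElem?_append_right (by simp [pair]; omega)]
    simp only [pair, List.length_cons, List.length_nil]
    rw [show 2 * (a' + 1) - (0 + 1 + 1) = 2 * a' by omega, show 2 * (a' + 1) + 1 - (0 + 1 + 1) = 2 * a' + 1 by omega,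
      show a + (a' + 1) = a + 1 + a' by omega]
    exact ih

omit [DecidableEq κ] [DecidableEq ι] in
/-- The clock test at a program address. [folklore] -/
theorem getElem?_tick_even (g : κ → ι) (clk : ι) (base X : ℕ) (P : AProg Bool κ) {a : ℕ} {ins : AInstr Bool κ}
    (h : P[a]? = some ins) :
    (tick g clk base X P)[2 * a]? = some (.pop clk (clkJump X (base + 2 * a + 1))) := by
  have h' := (getElem?_tickFrom g clk base P.length X 0 P a ins h).1
  rw [Nat.zero_add] at h'
  exact h'

omit [DecidableEq κ] [DecidableEq ι] in
/-- The instruction copy at a program address. [folklore] -/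
theorem getElem?_tick_odd (g : κ → ι) (clk : ι) (base X : ℕ) (P : AProg Bool κ) {a : ℕ} {ins : AInstr Bool κ}
    (h : P[a]? = some ins) : (tick g clk base X P)[2 * a + 1]? = some (reloc g base P.length ins) :=
  (getElem?_tickFrom g clk base P.length X 0 P a ins h).2

section Sim

variable {g : κ → ι} (hg : Injective g) {clk : ι} (hclk : ∀ k, g k ≠ clk)
variable (P : AProg Bool κ) (Q : AProg Bool ι) (base X : ℕ)
variable (hQ : Placed Q base (tick g clk base X P))

omit [DecidableEq κ] [DecidableEq ι] in
include hQ in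
/-- An instruction of the ticked program placed in `Q`. [folklore] -/
theorem getElem?_placed {i : ℕ} {ins : AInstr Bool ι} (h : (tick g clk base X P)[i]? = some ins) :
    Q[base + i]? = some ins := by
  have hi : i < (tick g clk base X P).length := (List.getElem?_eq_some_iff.1 h).1
  rw [hQ i hi]
  obtain ⟨_, h⟩ := List.getElem?_eq_some_iff.1 h
  rw [h]

/-- The store of the ticked program: the store of `P` grafted along `g` into a surrounding store
`S`, the clock holding `fuel`. [folklore] -/
noncomputable def tstore (S : AStore Bool ι) (g : κ → ι) (clk : ι) (R : AStore Bool κ) (fuel : List Bool) :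
    AStore Bool ι :=
  update (graft S g R) clk fuel

omit [DecidableEq κ] in
include hg hclk in
/-- Reading a renamed register of the ticked store. [folklore] -/
theorem tstore_apply_g (S : AStore Bool ι) (R : AStore Bool κ) (fuel : List Bool) (k : κ) :
    tstore S g clk R fuel (g k) = R k := by
  rw [tstore, update_of_ne (hclk k), graft_apply S hg]

omit [DecidableEq κ] in
/-- Reading the clock of the ticked store. [folklore] -/
@[simp] theorem tstore_clk (S : AStore Bool ι) (R : AStore Bool κ) (fuel : List Bool) :
    tstore S g clk R fuel clk = fuel := by simp [tstore]

include hg hclk in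
/-- Updating a renamed register of the ticked store. [folklore] -/
theorem update_tstore_g (S : AStore Bool ι) (R : AStore Bool κ) (fuel : List Bool) (k : κ) (v : List Bool) :
    update (tstore S g clk R fuel) (g k) v = tstore S g clk (update R k v) fuel := by
  rw [tstore, tstore, update_comm (hclk k).symm, graft_update_eq S hg]

omit [DecidableEq κ] in
/-- Updating the clock of the ticked store. [folklore] -/
@[simp] theorem update_tstore_clk (S : AStore Bool ι) (R : AStore Bool κ) (fuel v : List Bool) :
    update (tstore S g clk R fuel) clk v = tstore S g clk R v := by
  simp [tstore]

include hg hclk hQ in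
/-- **One instruction under the clock**: at a program address with a clock token, two steps of
`Q` take the step of `P` (targets saturated at `|P|`) and consume the token.
[cite: AroraBarak2009, §1.4.1] -/
theorem step_tick_fuel (S : AStore Bool ι) {pc : ℕ} (hpc : pc < P.length) (R : AStore Bool κ)
    (fuel : List Bool) :
    Q.step^[2] ⟨base + 2 * pc, tstore S g clk R (true :: fuel)⟩ =
      ⟨sat base P.length (P.step ⟨pc, R⟩).pc, tstore S g clk (P.step ⟨pc, R⟩).regs fuel⟩ := by
  obtain ⟨ins, hins⟩ : ∃ ins, P[pc]? = some ins := ⟨P[pc], List.getElem?_eq_getElem hpc⟩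
  have h1 := getElem?_placed P Q base X hQ (getElem?_tick_even g clk base X P hins)
  have h2 := getElem?_placed P Q base X hQ (getElem?_tick_odd g clk base X P hins)
  rw [show base + (2 * pc + 1) = base + 2 * pc + 1 by omega] at h2
  rw [Function.iterate_succ_apply, Function.iterate_one, Q.step_of_getElem? h1]
  simp only [tstore_clk, clkJump, update_tstore_clk]
  rw [Q.step_of_getElem? h2, P.step_of_getElem? hins]
  cases ins with
  | push k b => simp [reloc, sat, tstore_apply_g hg hclk, update_tstore_g hg hclk]; omega
  | goto j => simp [reloc]
  | pop k j =>
    simp only [reloc, tstore_apply_g hg hclk]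
    cases R k with
    | nil => rfl
    | cons a w => simp [update_tstore_g hg hclk]

omit [DecidableEq κ] in
include hQ in
/-- **An empty clock exits**: at a program address with an empty clock, one step of `Q` jumps
to `X`. [cite: AroraBarak2009, §1.4.1] -/
theorem step_tick_empty (S : AStore Bool ι) {pc : ℕ} (hpc : pc < P.length) (R : AStore Bool κ) :
    Q.step ⟨base + 2 * pc, tstore S g clk R []⟩ = ⟨X, tstore S g clk R []⟩ := by
  obtain ⟨ins, hins⟩ : ∃ ins, P[pc]? = some ins := ⟨P[pc], List.getElem?_eq_getElem hpc⟩
  have h1 := getElem?_placed P Q base X hQ (getElem?_tick_even g clk base X P hins)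
  rw [Q.step_of_getElem? h1]
  simp [clkJump]

include hg hclk hQ in
/-- **`n` unhalted steps under the clock**: if the first `n` configurations of the run of `P`
from `c` are inside the program and the clock holds at least `n` tokens, then `2n` steps of `Q`
reach the grafted `n`-th configuration (address saturated) with `n` tokens less.
[cite: AroraBarak2009, §1.4.1] -/
theorem iterate_tick (S : AStore Bool ι) : ∀ (n : ℕ) (c : ACfg Bool κ) (F : ℕ),
    (∀ m < n, (P.step^[m] c).pc < P.length) → n ≤ F →
    Q.step^[2 * n] ⟨sat base P.length c.pc, tstore S g clk c.regs (List.replicate F true)⟩ =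
      ⟨sat base P.length (P.step^[n] c).pc, tstore S g clk (P.step^[n] c).regs (List.replicate (F - n) true)⟩
  | 0, c, F, _, _ => by simp
  | n + 1, c, F, hin, hF => by
    have h0 : c.pc < P.length := by simpa using hin 0 (Nat.succ_pos n)
    obtain ⟨F', rfl⟩ : ∃ F', F = F' + 1 := ⟨F - 1, by omega⟩
    have e1 := step_tick_fuel hg hclk P Q base X hQ S h0 c.regs (List.replicate F' true)
    have ih := iterate_tick S n (P.step c) F' (fun m hm => by
      have := hin (m + 1) (by omega)
      rwa [Function.iterate_succ_apply] at this) (by omega)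
    rw [show 2 * (n + 1) = 2 * n + 2 by ring, Function.iterate_add_apply, sat, Nat.min_eq_left h0.le,
      List.replicate_succ, e1]
    rw [show (⟨c.pc, c.regs⟩ : ACfg Bool κ) = c from rfl] at *
    rw [ih, Function.iterate_succ_apply, Nat.add_sub_add_right]

include hg hclk hQ in
/-- **Exhaustion.** If the run of `P` from `c` is inside the program for its first `F + 1`
configurations (it needs more than `F` steps to halt), then with `F` clock tokens the ticked
program reaches the exit `X` after exactly `2F + 1` steps, with the grafted `F`-th configuration
and an empty clock. [cite: AroraBarak2009, §1.4.1] -/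
theorem tick_exhaust (S : AStore Bool ι) (c : ACfg Bool κ) (F : ℕ) (hin : ∀ m ≤ F, (P.step^[m] c).pc < P.length) :
    Q.step^[2 * F + 1] ⟨sat base P.length c.pc, tstore S g clk c.regs (List.replicate F true)⟩ =
      ⟨X, tstore S g clk (P.step^[F] c).regs []⟩ := by
  have h := iterate_tick hg hclk P Q base X hQ S F c F (fun m hm => hin m hm.le) le_rfl
  rw [Nat.sub_self, List.replicate_zero] at h
  have hF := hin F le_rfl
  rw [show 2 * F + 1 = 1 + 2 * F by ring, Function.iterate_add_apply, h, Function.iterate_one, sat,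
    Nat.min_eq_left hF.le, step_tick_empty P Q base X hQ S hF]

include hg hclk hQ in
/-- **Completion.** If the run of `P` from `c` is inside the program for its first `J`
configurations and halted at the `J`-th, then with `F ≥ J` clock tokens the ticked program is
at `base + 2|P|` after exactly `2J` steps, with the grafted halting configuration and `F - J`
tokens left. [cite: AroraBarak2009, §1.4.1] -/
theorem tick_complete (S : AStore Bool ι) (c : ACfg Bool κ) (J F : ℕ) (hin : ∀ m < J, (P.step^[m] c).pc < P.length)
    (hhalt : P.length ≤ (P.step^[J] c).pc) (hF : J ≤ F) :
    Q.step^[2 * J] ⟨sat base P.length c.pc, tstore S g clk c.regs (List.replicate F true)⟩ =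
      ⟨base + 2 * P.length, tstore S g clk (P.step^[J] c).regs (List.replicate (F - J) true)⟩ := by
  rw [iterate_tick hg hclk P Q base X hQ S J c F hin hF, sat, Nat.min_eq_right hhalt]

end Sim

/-! ### The halting time of a flat run -/

/-- **The first halting time** of a run that is halted at time `t`: a `J ≤ t` such that the run
is inside the program before `J` and halted (at the same configuration as at time `t`) at `J`.
[folklore] -/
theorem exists_haltTime (P : AProg Bool κ) (c : ACfg Bool κ) (t : ℕ) (ht : P.length ≤ (P.step^[t] c).pc) :
    ∃ J ≤ t, (∀ m < J, (P.step^[m] c).pc < P.length) ∧ P.length ≤ (P.step^[J] c).pc ∧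
      P.step^[J] c = P.step^[t] c := by
  classical
  have hex : ∃ J, P.length ≤ (P.step^[J] c).pc := ⟨t, ht⟩
  refine ⟨Nat.find hex, Nat.find_min' hex ht, fun m hm => Nat.lt_of_not_le (Nat.find_min hex hm),
    Nat.find_spec hex, ?_⟩
  have hJ := Nat.find_spec hex
  obtain ⟨d, hd⟩ : ∃ d, t = Nat.find hex + d := ⟨t - Nat.find hex, by have := Nat.find_min' hex ht; omega⟩
  rw [hd, Nat.add_comm, Function.iterate_add_apply, P.iterate_step_of_le hJ]

/-- The halting time is unique. [folklore] -/
theorem haltTime_unique (P : AProg Bool κ) (c : ACfg Bool κ) {J J' : ℕ}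
    (h₁ : ∀ m < J, (P.step^[m] c).pc < P.length) (h₂ : P.length ≤ (P.step^[J] c).pc)
    (h₁' : ∀ m < J', (P.step^[m] c).pc < P.length) (h₂' : P.length ≤ (P.step^[J'] c).pc) : J = J' := by
  by_contra hne
  rcases Nat.lt_or_gt_of_ne hne with h | h
  · exact absurd h₂ (not_le.2 (h₁' J h))
  · exact absurd h₂' (not_le.2 (h₁ J' h))

end FlatFuel

end Literature.Computability.Complexity
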